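import Mathlib.Analysis.SpecialFunctions.Pow.Real
import Mathlib.Analysis.SpecialFunctions.Complex.Log
import Mathlib.Analysis.Real.Pi.Bounds
import Mathlib.Analysis.Complex.Norm
import HarnessLib

/-!
# The band radius `h(n,T) = 2(n+1)/ℓ_T` of the BAND line of route «JensenLogBand»

RH ladder column JENSEN, rung J-P(P3) «log band», BAND crux `XiDerivBandRealAllRates`, line
«band-one-window» (u-arc reshape), lead rh-jensen-prover g7. RH-FREE real analysis. WHAT THIS IS
NOT: bookkeeping about the radius of a Cauchy circle; nothing here bears on zeros of `ζ` or the
truth of RH.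

* `LogBandArc.ell T = log(T/2π)` — the local log-height;
* `LogBandArc.bandRadius n T = 2(n+1)/ℓ_T` — the common radius of the two `u`-circles of the split
  (leading-order saddle modulus; at the top of the rate-`c` band `h ≈ 4/c`);
* `LogBandArc.bandRadius_admissible` — in the band (`64(n/log n)² ≤ ‖(a+iT)²‖`, `|a| ≤ ½`,
  `n ≥ 4⁹`): `0 < ℓ_T` and `0 < h(n,T) < 2T`;
* `LogBandArc.norm_sq_ofReal_add_mul_I`, `LogBandArc.neg_conj_ofReal_add_mul_I` — coordinates.
-/

noncomputable section

-- single-problem summit: `Summit.RiemannHypothesis.RiemannHypothesis.…` is the tree convention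
set_option linter.dupNamespace false

open Complex Real
open scoped ComplexConjugate

namespace Summit.RiemannHypothesis.RiemannHypothesis.Theorems.JensenPolynomials.LogBandArc

/-- `ℓ_T = log(T/2π)` — the local log-height (density of zeros of `ξ` at height `T` is `ℓ_T/2π`).
[folklore] -/
def ell (T : ℝ) : ℝ := Real.log (T / (2 * π))

/-- **The band radius** `h(n,T) = 2(n+1)/ℓ_T`: the leading-order modulus `|u* − v|` of the two
saddle points `u* ≈ v ± h` of `ξ(½+u) · K_{n,v}(u)` (`(log ξ)'(½ + v ± h) ≈ ±ℓ_T/2` balances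
`(n+1)/(u − v)`); at the top of the rate-`c` band (`ℓ_T ≈ cn/2`) `h ≈ 4/c`, so the right window sits
at abscissa `σ* ≈ ½ + a + 4/c`, right of the `1`-line exactly when `c < 8`. Both transforms of the
split use this ONE radius (a function of `n` and the height only). [folklore] -/
def bandRadius (n : ℕ) (T : ℝ) : ℝ := 2 * ((n : ℝ) + 1) / ell T

/-- `−conj(a + iT) = −a + iT`: the reflected centre in coordinates. [folklore] -/
theorem neg_conj_ofReal_add_mul_I (a T : ℝ) :
    -conj ((a : ℂ) + (T : ℂ) * I) = -(a : ℂ) + (T : ℂ) * I := by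
  apply Complex.ext <;> simp

/-- `‖(a + iT)²‖ = a² + T²`. [folklore] -/
theorem norm_sq_ofReal_add_mul_I (a T : ℝ) : ‖((a : ℂ) + (T : ℂ) * I) ^ 2‖ = a ^ 2 + T ^ 2 := by
  rw [norm_pow, Complex.norm_add_mul_I, Real.sq_sqrt (by positivity)]

/-- **The band radius is admissible (RH-free real analysis).** For `n ≥ 4⁹`, `|a| ≤ ½`, `T > 0`
and `64 (n/log n)² ≤ ‖(a+iT)²‖` (the lower edge of the band): `ℓ_T > 0` and `0 < h(n,T) < 2T`, so
`−v` lies outside the `u`-circle `|u − v| = h(n,T)` about `v = a + iT` and the split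
`LogBandArc.iteratedDeriv_xiSq_sq_eq_arcU_add` applies. (Chain: `log n ≤ 2√n` ⇒
`T ≥ 4n/log n ≥ 2√n` ⇒ `ℓ_T ≥ ½ log n − log 4 ≥ (3/8) log n` ⇒ `h ≤ 16(n+1)/(3 log n) < 8n/log n ≤ 2T`.)
[folklore] -/
theorem bandRadius_admissible : ∃ n₀ : ℕ, ∀ n : ℕ, n₀ ≤ n → ∀ a T : ℝ, |a| ≤ 1 / 2 → 0 < T →
    64 * ((n : ℝ) / Real.log n) ^ 2 ≤ ‖((a : ℂ) + (T : ℂ) * I) ^ 2‖ →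
    0 < ell T ∧ 0 < bandRadius n T ∧ bandRadius n T < 2 * T := by
  refine ⟨4 ^ 9, fun n hn a T ha hT hlo => ?_⟩
  have hn' : (4 : ℝ) ^ 9 ≤ (n : ℝ) := by exact_mod_cast hn
  have hn1 : (1 : ℝ) < n := by linarith
  have hn0 : (0 : ℝ) < n := by linarith
  have hlog4 : 0 < Real.log 4 := Real.log_pos (by norm_num)
  -- `log n ≥ 9 log 4`
  have hlogn : 9 * Real.log 4 ≤ Real.log n := by
    have : Real.log ((4 : ℝ) ^ 9) ≤ Real.log n := Real.log_le_log (by positivity) hn'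
    rwa [Real.log_pow] at this
  have hlogn_pos : 0 < Real.log n := by linarith
  -- `X = n / log n ≥ √n / 2`, via `log n ≤ 2 √n`
  set X : ℝ := (n : ℝ) / Real.log n with hX
  have hX_pos : 0 < X := div_pos hn0 hlogn_pos
  have hsqrt_pos : 0 < Real.sqrt n := Real.sqrt_pos.2 hn0
  have hlog_le : Real.log n ≤ 2 * Real.sqrt n := by
    have := Real.log_le_rpow_div hn0.le (by norm_num : (0 : ℝ) < 1 / 2)
    rw [← Real.sqrt_eq_rpow] at this
    linarith
  have hXge : Real.sqrt n / 2 ≤ X := by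
    rw [hX, le_div_iff₀ hlogn_pos]
    have hsq : Real.sqrt n * Real.sqrt n = n := Real.mul_self_sqrt hn0.le
    nlinarith
  -- `√n ≥ 2⁹`
  have hsqrt_ge : (2 : ℝ) ^ 9 ≤ Real.sqrt n := by
    rw [show ((2 : ℝ) ^ 9) = Real.sqrt (((2 : ℝ) ^ 9) ^ 2) by
      rw [Real.sqrt_sq (by positivity)]]
    exact Real.sqrt_le_sqrt (by norm_num at hn' ⊢; linarith)
  have hX_ge' : (2 : ℝ) ^ 8 ≤ X := by linarith
  -- `T ≥ 4 X`
  rw [norm_sq_ofReal_add_mul_I] at hlo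
  have ha2 : a ^ 2 ≤ 1 / 4 := by
    have : |a| ^ 2 ≤ (1 / 2) ^ 2 := pow_le_pow_left₀ (abs_nonneg a) ha 2
    rw [sq_abs] at this
    linarith
  have hT2 : (4 * X) ^ 2 ≤ T ^ 2 := by nlinarith
  have hT4X : 4 * X ≤ T := by
    by_contra hcon
    push Not at hcon
    nlinarith
  have hT_ge : 2 * Real.sqrt n ≤ T := by linarith
  -- `ℓ_T ≥ (1/2) log n − log 4 ≥ (3/8) log n`
  have hpi : (0 : ℝ) < 2 * π := by positivity
  have hTdiv : Real.sqrt n / 4 ≤ T / (2 * π) := by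
    rw [div_le_div_iff₀ (by norm_num) hpi]
    nlinarith [Real.pi_le_four, hsqrt_pos]
  have hell_ge : Real.log n / 2 - Real.log 4 ≤ ell T := by
    have h1 : Real.log (Real.sqrt n / 4) ≤ ell T :=
      Real.log_le_log (by positivity) hTdiv
    rw [Real.log_div hsqrt_pos.ne' (by norm_num), Real.log_sqrt hn0.le] at h1
    linarith
  have hell_ge' : 3 / 8 * Real.log n ≤ ell T := by linarith
  have hell_pos : 0 < ell T := by linarith
  refine ⟨hell_pos, div_pos (by positivity) hell_pos, ?_⟩
  -- `h = 2(n+1)/ℓ_T ≤ 16(n+1)/(3 log n) < 8 n/log n = 8X ≤ 2T`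
  rw [bandRadius, div_lt_iff₀ hell_pos]
  have h8X : 8 * X ≤ 2 * T := by linarith
  have hkey : 2 * ((n : ℝ) + 1) < 8 * X * (3 / 8 * Real.log n) := by
    rw [hX]
    field_simp
    nlinarith
  calc 2 * ((n : ℝ) + 1) < 8 * X * (3 / 8 * Real.log n) := hkey
    _ ≤ 2 * T * ell T := by
        apply mul_le_mul h8X hell_ge' (by positivity) (by positivity)


end Summit.RiemannHypothesis.RiemannHypothesis.Theorems.JensenPolynomials.LogBandArc

end
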